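import Summits.AtomisticToContinuum.HydrodynamicLimit.Theses.JParityClosure
import Summits.AtomisticToContinuum.HydrodynamicLimit.Theorems.PolynomialCompression.Negative.PdeForm

/-!
# Negative knowledge for crux `JParityClosure.OddContactSymmetry` (stmt-AtomisticToContinuum-17722, rev 5):
# the `t = 0` tie is data pinning, and continuity-only profiles are decoration

Standing disprover `refuter-cdisprove-stmt-AtomisticToContinuum-17722-0` (cycle 1 on the RESTATED crux, 2026-08-17),
companion of `Cruxes/OddContactSymmetry/Disproof.lean` §9 and of `RungZeroFrame.lean` (the third rev-5 insertion, the
shock clock `τ < T`, is void at global equilibrium).  The rev-5 restatement of the crux (ex stmt-13078) made exactly two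
changes: the weight `1 + e^{−F}` became the Metropolis acceptance `min 1 (e^{−F})` (audited in `ParityExactWeights.lean`,
`MetropolisMixture.lean`), and the statistic is now claimed only BEFORE THE FIRST SHOCK through three inserted
hypotheses — a classical hard-sphere-Euler solution `(ρ, u, θ)` on `[0, T)` (`IsHardSphereEulerSolution σ T ρ u θ`), the
`t = 0` law-of-large-numbers tie `TendstoHydroFieldsAt (fun N => localGibbsLaw σ a₀ u₀ θ₀ N (Φ N)) Φ ρ u θ 0`, and
`τ < T`.  This file settles, by pure logic over LANDED statics (`PolynomialCompressionPDE.lln_rhoLim`,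
`data_eq_of_flowFree`, `tendstoHydroFieldsAt_zero_iff_flowFree`, `continuous_slices_zero`), what the first two are worth:

* `oddContactSymmetry_iff_pinned` — **the tie is data pinning and nothing else.**  `OddContactSymmetry` is equivalent
  to `OddContactSymmetryPinned`, the statement in which the probabilistic tie is replaced by the three equations
  `ρ 0 = rhoLim (profileOf a₀) σ`, `u 0 = u₀`, `θ 0 = θ₀` (below the statics threshold `σ₁(a₀, θ₀, u₀) ≤ 1/2` the tie
  through ANY flow family holds iff the time-`0` slices are these; `T > 0` is forced by `0 < τ < T`, so the slices are
  continuous).  For the prover: no measure theory hides in the tie; the Euler data are the explicit cluster-series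
  density `rhoLim` and the profiles themselves.  For a refuter: a witness has no freedom in `(ρ, u, θ)` beyond the
  profiles — the classical solution is the one with the pinned data, and `T` is at most its classical lifespan.
* `oddContactSymmetry_iff_smoothKinematics` — **continuity-only profiles are decoration.**  The crux is equivalent to
  `OddContactSymmetrySmoothKinematics`, its restriction to SMOOTH velocity and temperature profiles (`Torus.IsSmooth u₀`,
  `Torus.IsSmooth θ₀`): with pinned data `u 0 = u₀`, `θ 0 = θ₀` and a classical solution on `[0, T)`, `T > 0`, the
  profiles are time-`0` slices of jointly smooth fields (`IsSmoothSpaceTimeOn.isSmooth_slice`); for non-smooth `u₀` or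
  `θ₀` the hypotheses are contradictory and the crux holds vacuously there.  The `∀`-over-continuous-profiles generality
  inherited from the conjunct `HydrodynamicLimit` carries no content for this item (the same holds for `a₀` through the
  smoothness of `rhoLim (profileOf a₀) σ = ρ 0`, not formalised here).

All statements are `OddContactSymmetry ↔ …` (no Theses decl is asserted).  Cycle-1 verdict on the restated crux: no kill;
every cheap mechanism of the 13078 record is either repaired (velocity-hole blow-up: weight `≤ 1`) or fenced (r-ball
mixtures: `∃ r₀(η)`, `MetropolisMixture.lean`; wild post-shock limits: `τ < T`), and what remains is the intended open
content (an `O(1)` J-odd pre-collisional contact correlation before the shock) — see Disproof §9.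
-/

noncomputable section

namespace Summit.AtomisticToContinuum.HydrodynamicLimit.Theorems

namespace OddContactSymmetryNegative

open MeasureTheory Filter Set Topology
open scoped ENNReal
open Literature.MathematicalPhysics.KineticTheory Literature.Analysis.FluidPDE
open Literature.Analysis.FunctionSpaces
open Summit.AtomisticToContinuum.HydrodynamicLimit.Theses.JParityClosure (OddContactSymmetry)
open PolynomialCompressionPDE

/-! ## The statistic's tail, and the crux unfolded -/

/-- The crux's body from `∀ χ` on — the Metropolis-weighted J-odd collision statistic `D` and the claim
`localGibbsLaw {η < |D|} ≤ δ` for `N ≥ N₀(r, ϑ)`, `r, ϑ < r₀(η, δ)` — as a function of the threshold `η₀`, the reduced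
density `σ`, the local-Gibbs profiles, the flow family and the horizon `τ`.  VERBATIM the text of
`JParityClosure.OddContactSymmetry` (stmt-AtomisticToContinuum-17722). -/
def OddStatTail (η₀ σ : ℝ) (a₀ : T3 → ℝ) (u₀ : T3 → V3) (θ₀ : T3 → ℝ) (Φ : Flows σ) (τ : ℝ) : Prop :=
  ∀ χ : ℝ × UnitAddTorus (Fin 3) → ℝ, Continuous χ → ∀ g : ℝ → ℝ, Continuous g → (∀ a, η₀ ≤ a → g a = 0) → ∀ Ψ : EuclideanSpace ℝ (Fin 3) × EuclideanSpace ℝ (Fin 3) × EuclideanSpace ℝ (Fin 3) → ℝ, Continuous Ψ → (∃ C : ℝ, ∀ q, |Ψ q| ≤ C) → (∀ (n v w : EuclideanSpace ℝ (Fin 3)), ‖n‖ = 1 → Ψ (-n, (Literature.Analysis.FluidPDE.reflectVel n (v, w)).1, (Literature.Analysis.FluidPDE.reflectVel n (v, w)).2) = -Ψ (n, v, w)) → ∀ η δ : ℝ, 0 < η → 0 < δ → ∃ r₀ : ℝ, 0 < r₀ ∧ ∀ r ϑ : ℝ, 0 < r → r < r₀ → 0 < ϑ → ϑ < r₀ →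 ∃ N₀ : ℕ, ∀ N : ℕ, N₀ ≤ N → let ε := Literature.MathematicalPhysics.KineticTheory.hsDiameter σ N; let G := Literature.Analysis.FluidPDE.Torus.geometry (Fin 3); let γ := fun z (s : ℝ) => (Φ N).flow s z; let bx : UnitAddTorus (Fin 3) → UnitAddTorus (Fin 3) → ℝ := fun x y => 3 / (Real.pi * r ^ 3) * max (1 - Literature.Analysis.FluidPDE.Torus.euclidDist x y / r) 0; let ρm := fun z s (x₀ : UnitAddTorus (Fin 3)) => ∫ q, bx q.1 x₀ ∂(Literature.Analysis.FluidPDE.empiricalMeasure (γ z s)); let hm := fun z s (x₀ : UnitAddTorus (Fin 3)) (v : EuclideanSpace ℝ (Fin 3)) => ∫ q, bx q.1 x₀ * Literature.Analysis.FluidPDE.localMaxwellian 1 (ϑ ^ 2) v q.2 ∂(Literature.Analysis.FluidPDE.empiricalMeasure (γ z s)); let pv := fun z s (i j : Fin (N + 1)) => Literature.Analysis.FluidPDE.reflectVel (G.sepVec (γ z s i).1 (γ z s j).1) ((γ z s i).2, (γ z s j).2); let F := fun z s (i j : Fin (N + 1)) => Real.log (hm z s (γ z s i).1 (pv z s i j).1)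 + Real.log (hm z s (γ z s i).1 (pv z s i j).2) - Real.log (hm z s (γ z s i).1 (γ z s i).2) - Real.log (hm z s (γ z s i).1 (γ z s j).2); let Kc := fun (Fn : Literature.Analysis.FluidPDE.Config (N + 1) (Fin 3) Literature.MathematicalPhysics.KineticTheory.T3 → ℝ → Fin (N + 1) → Fin (N + 1) → ℝ) z => ε / (N + 1 : ℝ) * ∑ᶠ (s : ℝ) (_ : s ∈ Literature.Analysis.FluidPDE.collisionTimes G ε (γ z) ∩ Set.Icc 0 τ), ∑ i : Fin (N + 1), ∑ j : Fin (N + 1), (if i ≠ j ∧ ‖G.sepVec (γ z s i).1 (γ z s j).1‖ = ε then Fn z s i j else 0); let D := fun z => Kc (fun z s i j => χ (s, (γ z s i).1) * g (σ ^ 3 * ρm z s (γ z s i).1) * (Ψ (ε⁻¹ • G.sepVec (γ z s i).1 (γ z s j).1, (pv z s i j).1, (pv z s i j).2) * min 1 (Real.exp (-F z s i j)))) z; Literature.MathematicalPhysics.KineticTheory.localGibbsLaw σ a₀ u₀ θ₀ N (Φ N) {z | η < |D z|} ≤ ENNReal.ofReal δ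

/-- The crux, unfolded down to its tail (definitional). [folklore] -/
theorem oddContactSymmetry_iff_tail :
    OddContactSymmetry ↔ ∃ η₀ : ℝ, 0 < η₀ ∧ ∀ (a₀ θ₀ : T3 → ℝ) (u₀ : T3 → V3), Continuous a₀ → Continuous θ₀ →
      Continuous u₀ → (∀ x, 0 < a₀ x) → (∀ x, 0 < θ₀ x) → ∃ σ₀ : ℝ, 0 < σ₀ ∧ ∀ σ : ℝ, 0 < σ → σ < σ₀ →
      ∀ (T : ℝ) (ρ θ : ℝ → T3 → ℝ) (u : ℝ → T3 → V3), IsHardSphereEulerSolution σ T ρ u θ →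
      ∀ Φ : Flows σ, TendstoHydroFieldsAt (fun N => localGibbsLaw σ a₀ u₀ θ₀ N (Φ N)) Φ ρ u θ 0 →
      ∀ τ : ℝ, 0 < τ → τ < T → OddStatTail η₀ σ a₀ u₀ θ₀ Φ τ :=
  Iff.rfl

/-! ## (i) The tie is data pinning -/

/-- **`OddContactSymmetry` with the probabilistic `t = 0` tie replaced by PINNED DATA**: the classical solution has
`ρ 0 = rhoLim (profileOf a₀) σ`, `u 0 = u₀`, `θ 0 = θ₀`; no law of large numbers, no flow in the hypotheses on
`(ρ, u, θ)`.  Equivalent to the crux (`oddContactSymmetry_iff_pinned`). -/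
def OddContactSymmetryPinned : Prop :=
  ∃ η₀ : ℝ, 0 < η₀ ∧ ∀ (a₀ θ₀ : T3 → ℝ) (u₀ : T3 → V3) (ha : Continuous a₀), Continuous θ₀ →
    Continuous u₀ → ∀ (ha0 : ∀ x, 0 < a₀ x), (∀ x, 0 < θ₀ x) → ∃ σ₀ : ℝ, 0 < σ₀ ∧ ∀ σ : ℝ, 0 < σ → σ < σ₀ →
    ∀ (T : ℝ) (ρ θ : ℝ → T3 → ℝ) (u : ℝ → T3 → V3), IsHardSphereEulerSolution σ T ρ u θ →
    ρ 0 = rhoLim (profileOf a₀ ha ha0) σ → u 0 = u₀ → θ 0 = θ₀ →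
    ∀ Φ : Flows σ, ∀ τ : ℝ, 0 < τ → τ < T → OddStatTail η₀ σ a₀ u₀ θ₀ Φ τ

/-- **The tie is data pinning and nothing else**: `OddContactSymmetry ↔ OddContactSymmetryPinned`.  Both directions
shrink `σ₀` below the statics threshold `σ₁(a₀, θ₀, u₀) ≤ 1/2` of `lln_rhoLim`; `T > 0` from `0 < τ < T` makes the
time-`0` slices continuous (`continuous_slices_zero`), and then the tie through the given flow family holds iff the
slices are `(rhoLim (profileOf a₀) σ, u₀, θ₀)` (`tendstoHydroFieldsAt_zero_iff_flowFree`, `data_eq_of_flowFree`).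
[folklore] -/
theorem oddContactSymmetry_iff_pinned : OddContactSymmetry ↔ OddContactSymmetryPinned := by
  constructor
  · rintro ⟨η₀, hη₀, H⟩
    refine ⟨η₀, hη₀, fun a₀ θ₀ u₀ ha hθ hu ha0 hθ0 => ?_⟩
    obtain ⟨σ₀, hσ₀, Hσ⟩ := H a₀ θ₀ u₀ ha hθ hu ha0 hθ0
    obtain ⟨σ₁, hσ₁, -, G⟩ := lln_rhoLim (u₀ := u₀) ha hθ hu ha0 hθ0
    refine ⟨min σ₀ σ₁, lt_min hσ₀ hσ₁, fun σ hσ hσlt T ρ θ u hE h1 h2 h3 Φ τ hτ hτT => ?_⟩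
    have hσ0' : σ < σ₀ := lt_of_lt_of_le hσlt (min_le_left _ _)
    have hσ1' : σ < σ₁ := lt_of_lt_of_le hσlt (min_le_right _ _)
    obtain ⟨-, -, Gσ⟩ := G σ hσ hσ1'
    have htie : TendstoHydroFieldsAt (fun N => localGibbsLaw σ a₀ u₀ θ₀ N (Φ N)) Φ ρ u θ 0 := by
      refine (tendstoHydroFieldsAt_zero_iff_flowFree Φ).2 ?_
      rw [h1, h2, h3]
      -- no expected type on the next line: `(fun _ => c) 0` must beta-reduce on instantiation (cf. `admissible_iff_data`)
      have hff := (tendstoHydroFieldsAt_zero_iff_flowFree Φ).1 (Gσ Φ).2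
      exact hff
    exact Hσ σ hσ hσ0' T ρ θ u hE Φ htie τ hτ hτT
  · rintro ⟨η₀, hη₀, H⟩
    refine ⟨η₀, hη₀, fun a₀ θ₀ u₀ ha hθ hu ha0 hθ0 => ?_⟩
    obtain ⟨σ₀, hσ₀, Hσ⟩ := H a₀ θ₀ u₀ ha hθ hu ha0 hθ0
    obtain ⟨σ₁, hσ₁, hσ₁2, G⟩ := lln_rhoLim (u₀ := u₀) ha hθ hu ha0 hθ0
    refine ⟨min σ₀ σ₁, lt_min hσ₀ hσ₁, fun σ hσ hσlt T ρ θ u hE Φ htie τ hτ hτT => ?_⟩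
    have hσ0' : σ < σ₀ := lt_of_lt_of_le hσlt (min_le_left _ _)
    have hσ1' : σ < σ₁ := lt_of_lt_of_le hσlt (min_le_right _ _)
    have hσ2 : σ ≤ 1 / 2 := (hσ1'.trans_le hσ₁2).le
    obtain ⟨h, hpos, Gσ⟩ := G σ hσ hσ1'
    obtain ⟨hρc, huc, hθc⟩ := continuous_slices_zero hE (hτ.trans hτT)
    have hlln := (tendstoHydroFieldsAt_zero_iff_flowFree Φ).1 (Gσ Φ).2
    have ht := (tendstoHydroFieldsAt_zero_iff_flowFree Φ).1 htie
    obtain ⟨h1, h2, h3⟩ := data_eq_of_flowFree ha hθ hu ha0 hθ0 hσ2 h.continuous_rhoLim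
      (fun x => h.rhoLim_pos (hpos x)) hlln hρc huc hθc ht
    exact Hσ σ hσ hσ0' T ρ θ u hE h1 h2 h3 Φ τ hτ hτT

/-! ## (ii) Continuity-only profiles are decoration -/

/-- **`OddContactSymmetry` restricted to SMOOTH kinematic profiles**: verbatim the crux with the two extra hypotheses
`Torus.IsSmooth u₀`, `Torus.IsSmooth θ₀`.  Equivalent to the crux (`oddContactSymmetry_iff_smoothKinematics`).
-/
def OddContactSymmetrySmoothKinematics : Prop :=
  ∃ η₀ : ℝ, 0 < η₀ ∧ ∀ (a₀ θ₀ : T3 → ℝ) (u₀ : T3 → V3), Continuous a₀ → Continuous θ₀ →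
    Continuous u₀ → (∀ x, 0 < a₀ x) → (∀ x, 0 < θ₀ x) → Torus.IsSmooth u₀ → Torus.IsSmooth θ₀ →
    ∃ σ₀ : ℝ, 0 < σ₀ ∧ ∀ σ : ℝ, 0 < σ → σ < σ₀ →
    ∀ (T : ℝ) (ρ θ : ℝ → T3 → ℝ) (u : ℝ → T3 → V3), IsHardSphereEulerSolution σ T ρ u θ →
    ∀ Φ : Flows σ, TendstoHydroFieldsAt (fun N => localGibbsLaw σ a₀ u₀ θ₀ N (Φ N)) Φ ρ u θ 0 →
    ∀ τ : ℝ, 0 < τ → τ < T → OddStatTail η₀ σ a₀ u₀ θ₀ Φ τ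

/-- **Continuity-only profiles are decoration**: `OddContactSymmetry ↔ OddContactSymmetrySmoothKinematics`.  For
profiles with non-smooth `u₀` or `θ₀` the crux's hypotheses are contradictory below the statics threshold: the tie
pins `u 0 = u₀`, `θ 0 = θ₀` (`data_eq_of_flowFree`), `0 < τ < T` gives `T > 0`, and time-`0` slices of a classical
solution are smooth (`IsSmoothSpaceTimeOn.isSmooth_slice`). [folklore] -/
theorem oddContactSymmetry_iff_smoothKinematics : OddContactSymmetry ↔ OddContactSymmetrySmoothKinematics := by
  constructor
  · rintro ⟨η₀, hη₀, H⟩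
    exact ⟨η₀, hη₀, fun a₀ θ₀ u₀ ha hθ hu ha0 hθ0 _ _ => H a₀ θ₀ u₀ ha hθ hu ha0 hθ0⟩
  · rintro ⟨η₀, hη₀, H⟩
    refine ⟨η₀, hη₀, fun a₀ θ₀ u₀ ha hθ hu ha0 hθ0 => ?_⟩
    obtain ⟨σ₁, hσ₁, hσ₁2, G⟩ := lln_rhoLim (u₀ := u₀) ha hθ hu ha0 hθ0
    by_cases hsm : Torus.IsSmooth u₀ ∧ Torus.IsSmooth θ₀
    · obtain ⟨σ₀, hσ₀, Hσ⟩ := H a₀ θ₀ u₀ ha hθ hu ha0 hθ0 hsm.1 hsm.2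
      exact ⟨σ₀, hσ₀, Hσ⟩
    · refine ⟨σ₁, hσ₁, fun σ hσ hσlt T ρ θ u hE Φ htie τ hτ hτT => ?_⟩
      exfalso
      have hT : 0 < T := hτ.trans hτT
      have hσ2 : σ ≤ 1 / 2 := (hσlt.trans_le hσ₁2).le
      obtain ⟨h, hpos, Gσ⟩ := G σ hσ hσlt
      obtain ⟨hρc, huc, hθc⟩ := continuous_slices_zero hE hT
      have hlln := (tendstoHydroFieldsAt_zero_iff_flowFree Φ).1 (Gσ Φ).2
      have ht := (tendstoHydroFieldsAt_zero_iff_flowFree Φ).1 htie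
      obtain ⟨-, h2, h3⟩ := data_eq_of_flowFree ha hθ hu ha0 hθ0 hσ2 h.continuous_rhoLim
        (fun x => h.rhoLim_pos (hpos x)) hlln hρc huc hθc ht
      have h0 : (0 : ℝ) ∈ Ico 0 T := ⟨le_rfl, hT⟩
      have hus : Torus.IsSmooth (u 0) := hE.smooth_velocity.isSmooth_slice h0
      have hθs : Torus.IsSmooth (θ 0) := hE.smooth_temperature.isSmooth_slice h0
      rw [h2] at hus
      rw [h3] at hθs
      exact hsm ⟨hus, hθs⟩

end OddContactSymmetryNegative

end Summit.AtomisticToContinuum.HydrodynamicLimit.Theorems
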